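import Literature.Geometry.Kaehler.ComplexTorusCMLefschetzGroupConnected
import Literature.Geometry.Kaehler.ComplexTorusLefschetzGroupSigmaPiIdentityComponent
import HarnessLib

/-!
# Milne 1999 §2, «simple abelian variety of type I», at torus level: for a polarised complex torus whose
# endomorphism algebra is commutative, semisimple and POINTWISE FIXED by the Rosati involution (real multiplication),
# `S(X)(ℂ) = P · ∏_σ Sp(H_σ) · P⁻¹` in a common eigenbasis of `End_ℚ(X) ⊗ ℂ`, hence CONNECTED:
# `Lf(X)(ℂ) = S(X)(ℂ)` — the «Connected: Yes» entry of Milne's table, type I, every degree `e = [F : ℚ]`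

Layer `Literature/Geometry/Kaehler`, namespace `Literature.Geometry.Kaehler.ComplexTorus`; lane `lit-hodgefound`
(Track 2 foundations library), Layer A4 (Lefschetz groups), skeleton seat `lit-hodgefound-skel-4` (generation 35),
self-minted row A4-93 of `run/shared/lean/pub/lit-hodgefound/SKELETON.md` = the type I entry of the GAP row A4-90
(«Milne's Summary table, the "Connected: Yes" entries at torus level»), sequel of A4-92
(`ComplexTorusCMLefschetzGroupConnected`: the CM entry; its §B common eigenbasis `exists_forall_map_eq_conj_diagonal`,
§C `rosati_conj_diagonal_eq_iff`, `frameGram_alternating` are consumed BY NAME). CONCRETE torus level, model-free: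
`X = E/Φ(ℤ^ι)`, `End_ℚ(X) = endAlgRat Φ ⊆ M_ι(ℚ)`, Milne's `S(X)(ℂ) = lefschetzGroupC Φ G ≤ SL_ι(ℂ)` and Lange's
`Lf(X)(ℂ) = lefschetzIdentityC Φ G = S(X)(ℂ)⁰` (p17's `ComplexTorusLefschetzGroupIdentityComponent`). The case
`e = 1` (`End_ℚ(X) = ℚ`, `S(X) = Sp(V, E)`) is p22's `IsRiemannForm.lefschetzIdentityC_eq_lefschetzGroupC_of_endAlgRat_eq_bot`
(`ComplexTorusSymplecticGroupGramConnected`); this file does every `e`.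

## Sources, verbatim

* J. S. Milne, *Lefschetz classes on abelian varieties*, Duke Math. J. 96 (1999) (held
  `paper:doi-10-1215-s0012-7094-99-09620-5`), §2 Preliminaries, p. 646 (p0008 L52–L66): «Let `F ⊗_ℚ k = F₁ × ⋯ × F_t`
  be the decomposition of `F ⊗_ℚ k` into a product of fields, and let `1 = e₁ + ⋯ + e_t` be the corresponding
  decomposition of `1` into a sum of orthogonal idempotents. Then `V(A) = V₁ ⊕ ⋯ ⊕ V_t`, `V_i = e_i V` … Any
  `k`-linear map `α : V → V` commuting with the action of `F` decomposes into `α = α₁ ⊕ ⋯ ⊕ α_t`, `α_i : V_i → V_i`»;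
  p. 647 (p0009 L3–L8): «let `φ : V × V → F ⊗_ℚ k` be the skew-symmetric `F ⊗_ℚ k`-bilinear form such that
  `Tr φ = e_D`. Because `φ ∘ (α × 1) = φ ∘ (1 × α)` for `α ∈ F`, `φ` decomposes into `φ = φ₁ ⊕ ⋯ ⊕ φ_t`»;
  «Simple abelian variety of type I», p. 648–649 (p0010 L44 – p0011 L14): «In this case `E = F`. … Here `φ_i` is a
  nondegenerate skew-symmetric form on the `F_i`-vector space `V_i`. Therefore, `C(A) = C₁ × ⋯ × C_t`,
  `C_i = End_{F_i}(V_i) ≈ M_{2g/f}(F_i)` and the involution sends an element of `C_i` to its adjoint with respect to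
  `φ_i`. Moreover, `S(A) = S₁ × ⋯ × S_t`, `S_i = Res_{F_i/k} Sp(φ_i)`. Similarly, if `F ⊗_ℚ k^al = ∏ k_σ` …
  `S(A)_{k^al} ≅ ∏_{σ:F→k^al} Sp(φ_σ)`»; Summary table, p. 652 (p0014 L5–L12): «Type ∣ Group ∣ Semisimple ∣ Connected …
  I ∣ Sp_{2g/f} ∣ Yes ∣ Yes».
* T. A. Springer, *Linear Algebraic Groups*, 2nd ed. (1998): Exercise 2.2.9 (1)(b) («`Sp_{2n}` is connected»; tree:
  `isPrime_vanishingIdealC_symplecticGroupC`), Thm. 1.5.4 (ii) (products of irreducible varieties; tree: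
  `isPrime_vanishingIdealC_sigmaPi_map`), Prop. 2.2.1, 2.4.2 (ii) (simultaneous diagonalisation).
* D. McDuff, D. Salamon, *Introduction to Symplectic Topology*, 3rd ed. (2017), Thm. 2.1.3 (symplectic basis; tree:
  `Literature.Geometry.Symplectic.exists_symplecticBasis`, over any field), Lemma 2.1.6 area («`Sp ⊂ SL`»; Mathlib
  `SymplecticGroup.det_eq_one`).
* H. Lange, *Abelian Varieties over the Complex Numbers* (2023), §2.4.1 Lemma 2.4.1 (the Rosati involution), §7.2.4
  Exercise (4) (`Lf(X)`).

## The argument, and what is proved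

* §1 COMPLEX SYMPLECTIC GROUPS (any finite index type `κ`): **`exists_transpose_mul_mul_eq_J_submatrix_complex`**
  (symplectic basis theorem over `ℂ` in matrices: `ᵗQ H Q = J.submatrix e e` for `ᵗH = -H`, `det H ≠ 0` — the
  rational twin is p22's `exists_transpose_mul_mul_eq_J_submatrix`), **`det_eq_one_of_transpose_mul_mul_eq_complex`**
  (`ᵗM H M = H ⟹ det M = 1`), `mem_map_map_symplecticGroupC_iff` (`Q · (Sp_{2n}(ℂ) reindexed) · Q⁻¹ = {ᵗN H N = H}`)
  and `isZariskiClosed_and_isPrime_map_map_symplecticGroupC` (each `Sp(H)(ℂ)` is Zariski-closed and irreducible).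
* §2 FRAME ALGEBRA: `conj_symplectic_iff` (`ᵗ(P B P⁻¹) Γ (P B P⁻¹) = Γ ⟺ ᵗB H B = H`, `H = ᵗP Γ P`), commutation of
  conjugates, and «commutes with `diag(c)` iff the entries vanish where `c` differs».
* §3 TYPE I: **`isPrime_vanishingIdealC_lefschetzGroupC_of_rosati_eq_self`** — hypotheses: `End_ℚ(X)` commutative and
  reduced, `ᵗG = -G`, `det G ≠ 0`, `rosati G A = A` on `End_ℚ(X)`. Proof, following Milne: common eigenbasis `P`
  (A4-92 §B) and characters `c_A`; the eigenlines are partitioned by the relation «same character» (a `Setoid` on `ι`,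
  classes `q`, fibres reindexed along `Equiv.sigmaFiberEquiv : (Σ q, fibre q) ≃ ι`); `†` trivial on `F` gives
  `diag(c_A) H = H diag(c_A)`, so `H` vanishes across classes («`φ = φ₁ ⊕ ⋯ ⊕ φ_t`») and its blocks `H_q` are alternating
  and invertible; `M ∈ S(X)(ℂ)` iff `B = P⁻¹ M P` vanishes across classes («`α = α₁ ⊕ ⋯ ⊕ α_t`») and `ᵗB H B = H`, iff
  the reindexed `B` is `diag(B_q)` with `ᵗB_q H_q B_q = H_q` (`det B_q = 1` by §1) — so
  `S(X)(ℂ) = P · (∏_q Sp(H_q)(ℂ)) · P⁻¹` as subgroups (`Subgroup.pi` pushed along p36's `sigmaBlockDiagSL`, then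
  `reindexSLC`, then `conjGLC`), and primality is p36's `isPrime_vanishingIdealC_sigmaPi_map` transported by
  `isPrime_vanishingIdealC_map_reindexSLC` / `_map_conjGLC`. Consequences:
  **`lefschetzIdentityC_eq_lefschetzGroupC_of_rosati_eq_self`** (`Lf(X)(ℂ) = S(X)(ℂ)`), the polarised forms
  **`IsRiemannForm.lefschetzIdentityC_eq_lefschetzGroupC_of_rosati_eq_self`** /
  `IsRiemannForm.isPrime_vanishingIdealC_lefschetzGroupC_of_rosati_eq_self` (reducedness from Poincaré,
  `IsRiemannForm.isSemisimpleRing_endAlgRat`) and the real points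
  `IsRiemannForm.lefschetzIdentity_eq_lefschetzGroup_of_rosati_eq_self` (`Lf(X)(ℝ) = lefschetzGroup Φ η`).
* §4 THROUGH THE ISOGENY FACTORS (A4-89), types I and CM mixed:
  **`IsIsogenous.lefschetzIdentityC_eq_lefschetzGroupC_of_powers_of_rosati_eq_self_or_comm`** — `X ∼ ∏ₖ B_k^{n_k}`
  with every `End_ℚ(B_k)` commutative and EITHER Rosati-fixed (real multiplication) OR of dimension `2 dim B_k`
  (complex multiplication) ⟹ `Lf(X)(ℂ) = S(X)(ℂ)` (Milne Prop. 1.5 with the «Connected: Yes» entries I and IV (`d = 1`)).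

THEOREMS ONLY (no definition, no instance, no notation, no named fact; D-0026, net debt 0).

NOT here: the general (non-commutative) entries of Milne's table — type II, type IV with `d > 1` (matrix blocks
`M_d`), type I with `End_ℚ(X) ⊋ F`; the identification of the classes `q` with the embeddings `σ : F → ℝ` and of
`Sp(H_q)` with `Sp(φ_σ)` over `F ⊗_σ ℂ` as printed (here the classes are read off the eigenbasis).

## References

* [Milne1999LefschetzClasses] J. S. Milne, *Lefschetz classes on abelian varieties*, Duke Math. J. 96 (1999),
  639–675: §2 Preliminaries (p. 646–647), «Simple abelian variety of type I» (p. 648–649), Summary table (p. 652);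
  §1 Prop. 1.5.
* [Springer1998] T. A. Springer, *Linear Algebraic Groups*, 2nd ed., Birkhäuser (1998), Exercise 2.2.9 (1)(b),
  Thm. 1.5.4 (ii), Prop. 2.2.1, 2.4.2 (ii).
* [McDuffSalamon2017] D. McDuff, D. Salamon, *Introduction to Symplectic Topology*, 3rd ed., OUP (2017), Thm. 2.1.3.
* [Lange2023AbelianVarietiesComplex] H. Lange, *Abelian Varieties over the Complex Numbers*, Springer (2023), §2.4.1
  Lemma 2.4.1, §7.2.4 Exercise (4).
* [Gordon1999HodgeAVSurvey] B. B. Gordon, *A survey of the Hodge conjecture for abelian varieties* (1999), App. B,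
  §7.7 («for type (I), a symplectic group … as a standard symplectic representation»), 2.15 Lemma.
-/

noncomputable section

open Matrix

namespace Literature.Geometry.Kaehler

namespace ComplexTorus

/-! ## §1 The symplectic basis theorem over `ℂ` in matrices; complex symplectic groups are conjugates of the
standard one; `det = 1` -/

section ComplexSymplectic

variable {κ : Type*} [Fintype κ] [DecidableEq κ]

omit [DecidableEq κ] in
/-- `(column i of P) · H (column j of P) = (ᵗP H P)_{ij}`. [folklore] -/
private theorem col_dotProduct_mulVec_col' (P H : Matrix κ κ ℂ) (i j : κ) :
    (fun k ↦ P k i) ⬝ᵥ (H *ᵥ fun k ↦ P k j) = (Pᵀ * H * P) i j := by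
  simp only [Matrix.mul_apply, Matrix.transpose_apply, dotProduct, Matrix.mulVec, Finset.sum_mul, Finset.mul_sum]
  rw [Finset.sum_comm]
  exact Finset.sum_congr rfl fun a _ ↦ Finset.sum_congr rfl fun c _ ↦ by ring

/-- A skew-symmetric complex matrix defines an alternating bilinear form `ᵗx H y`.
[cite: McDuffSalamon2017, Thm. 2.1.3 (hypothesis: `ω` skew-symmetric)] -/
private theorem isAlt_toBilin'_of_transpose_eq_neg' {H : Matrix κ κ ℂ} (hHt : Hᵀ = -H) : (Matrix.toBilin' H).IsAlt := by
  intro x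
  have h : x ⬝ᵥ (H *ᵥ x) = -(x ⬝ᵥ (H *ᵥ x)) := by
    conv_lhs => rw [Matrix.dotProduct_mulVec, ← Matrix.mulVec_transpose, hHt, Matrix.neg_mulVec, neg_dotProduct,
      dotProduct_comm]
  rw [Matrix.toBilin'_apply']
  have h2 : x ⬝ᵥ (H *ᵥ x) + x ⬝ᵥ (H *ᵥ x) = 0 := by linear_combination h
  exact add_self_eq_zero.1 h2

/-- **The symplectic basis theorem over `ℂ`, matrix form**: a skew-symmetric complex matrix `H` with `det H ≠ 0`
is congruent to the standard form — there are `n`, `e : κ ≃ Fin n ⊕ Fin n` and `Q ∈ GL_κ(ℂ)` with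
`ᵗQ H Q = J.submatrix e e`, `J = (0 −1; 1 0)` (the rational case is `exists_transpose_mul_mul_eq_J_submatrix`).
[cite: McDuffSalamon2017, Thm. 2.1.3] [cite: Milne1999LefschetzClasses, §2 type I («`φ_σ` … `Sp(φ_σ)`»)] -/
theorem exists_transpose_mul_mul_eq_J_submatrix_complex {H : Matrix κ κ ℂ} (hHt : Hᵀ = -H) (hdet : IsUnit H.det) :
    ∃ (n : ℕ) (e : κ ≃ Fin n ⊕ Fin n) (Q : Matrix κ κ ℂ), IsUnit Q.det ∧
      Qᵀ * H * Q = (Matrix.J (Fin n) ℂ).submatrix e e := by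
  classical
  have hA : (Matrix.toBilin' H).IsAlt := isAlt_toBilin'_of_transpose_eq_neg' hHt
  have hN : (Matrix.toBilin' H).Nondegenerate :=
    LinearMap.BilinForm.nondegenerate_toBilin'_iff_det_ne_zero.2 hdet.ne_zero
  obtain ⟨n, b, huu, hvv, huv⟩ := Literature.Geometry.Symplectic.exists_symplecticBasis (Matrix.toBilin' H) hA hN
  set c : Module.Basis (Fin n ⊕ Fin n) ℂ (κ → ℂ) := b.reindex (Equiv.sumComm (Fin n) (Fin n)) with hc
  have hc_inl : ∀ i, c (Sum.inl i) = b (Sum.inr i) := fun i ↦ by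
    rw [hc, Module.Basis.reindex_apply, Equiv.sumComm_symm, Equiv.sumComm_apply, Sum.swap_inl]
  have hc_inr : ∀ i, c (Sum.inr i) = b (Sum.inl i) := fun i ↦ by
    rw [hc, Module.Basis.reindex_apply, Equiv.sumComm_symm, Equiv.sumComm_apply, Sum.swap_inr]
  have hcJ : ∀ u v, Matrix.toBilin' H (c u) (c v) = Matrix.J (Fin n) ℂ u v := by
    rintro (i | i) (j | j)
    · rw [hc_inl, hc_inl, hvv, Matrix.J, Matrix.fromBlocks_apply₁₁, Matrix.zero_apply]
    · rw [hc_inl, hc_inr, ← hA.neg_eq, huv, Matrix.J, Matrix.fromBlocks_apply₁₂, Matrix.neg_apply, Matrix.one_apply]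
      simp only [eq_comm]
    · rw [hc_inr, hc_inl, huv, Matrix.J, Matrix.fromBlocks_apply₂₁, Matrix.one_apply]
    · rw [hc_inr, hc_inr, huu, Matrix.J, Matrix.fromBlocks_apply₂₂, Matrix.zero_apply]
  set e : κ ≃ Fin n ⊕ Fin n := (c.indexEquiv (Pi.basisFun ℂ κ)).symm with he
  set d : Module.Basis κ ℂ (κ → ℂ) := c.reindex e.symm with hd
  have hd_apply : ∀ k, d k = c (e k) := fun k ↦ by rw [hd, Module.Basis.reindex_apply, Equiv.symm_symm]
  refine ⟨n, e, (Pi.basisFun ℂ κ).toMatrix d,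
    Matrix.isUnit_det_of_right_inverse (Module.Basis.toMatrix_mul_toMatrix_flip _ _), ?_⟩
  have hcol : ∀ k : κ, (fun a ↦ (Pi.basisFun ℂ κ).toMatrix d a k) = d k := fun k ↦ funext fun a ↦ by
    rw [Module.Basis.toMatrix_apply, Pi.basisFun_repr]
  ext i' j'
  rw [← col_dotProduct_mulVec_col', hcol, hcol, ← Matrix.toBilin'_apply', Matrix.submatrix_apply, hd_apply, hd_apply,
    hcJ]

/-- **Symplectic matrices have determinant one, over `ℂ`, for ANY non-degenerate alternating `H`**: `ᵗM H M = H ⟹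
det M = 1` (transport to the standard `Sp_{2n}(ℂ)` and Mathlib's `SymplecticGroup.det_eq_one`).
[cite: McDuffSalamon2017, Thm. 2.1.3 and Lemma 2.1.6 («`Sp(2n) ⊂ SL(2n)`»)] [cite: Milne1999LefschetzClasses, §1 (p. 644: `S(A) ⊆ Sp(e_D)`)] -/
theorem det_eq_one_of_transpose_mul_mul_eq_complex {H : Matrix κ κ ℂ} (hHt : Hᵀ = -H) (hdet : IsUnit H.det)
    {M : Matrix κ κ ℂ} (hM : Mᵀ * H * M = H) : M.det = 1 := by
  obtain ⟨n, e, Q, hQ, hQHQ⟩ := exists_transpose_mul_mul_eq_J_submatrix_complex hHt hdet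
  set X : Matrix κ κ ℂ := Q⁻¹ * M * Q with hX
  have hX' : (X.submatrix e.symm e.symm)ᵀ * Matrix.J (Fin n) ℂ * X.submatrix e.symm e.symm = Matrix.J (Fin n) ℂ :=
    (transpose_mul_mul_submatrix_eq_iff e _ X).2 ((transpose_mul_mul_eq_iff_conj hQ hQHQ M).1 hM)
  have hdetX : X.det = 1 := by
    rw [← Matrix.det_submatrix_equiv_self e.symm X]
    exact SymplecticGroup.det_eq_one (SymplecticGroup.mem_iff'.2 hX')
  rwa [hX, Matrix.det_conj' ((Matrix.isUnit_iff_isUnit_det _).2 hQ)] at hdetX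

/-- **The complex symplectic group of `H` as a transported standard group**: for `ᵗQ H Q = J.submatrix e e`,
membership of `N ∈ SL_κ(ℂ)` in `Q · (Sp_{2n}(ℂ) reindexed along e⁻¹) · Q⁻¹` is exactly `ᵗN H N = H`.
[cite: McDuffSalamon2017, Thm. 2.1.3 (change of symplectic basis)] [cite: Springer1998, Exercise 2.2.9 (1)(b)] -/
theorem mem_map_map_symplecticGroupC_iff {n : ℕ} {e : κ ≃ Fin n ⊕ Fin n} {Q H : Matrix κ κ ℂ} (hQ : IsUnit Q.det)
    (hQHQ : Qᵀ * H * Q = (Matrix.J (Fin n) ℂ).submatrix e e) {N : Matrix.SpecialLinearGroup κ ℂ} :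
    N ∈ ((symplecticGroupC (Fin n)).map (reindexSLC e.symm).toMonoidHom).map (conjGLC Q hQ).toMonoidHom ↔
      N.1ᵀ * H * N.1 = H := by
  rw [Subgroup.mem_map_equiv, Subgroup.mem_map_equiv, mem_symplecticGroupC_iff', coe_reindexSLC_symm,
    coe_conjGLC_symm, transpose_mul_mul_eq_iff_conj hQ hQHQ, transpose_mul_mul_submatrix_eq_iff]

/-- The transported standard group is Zariski-closed and irreducible. [cite: Springer1998, Exercise 2.2.9 (1)(b) and Prop. 2.2.1] -/
theorem isZariskiClosed_and_isPrime_map_map_symplecticGroupC {n : ℕ} (e : κ ≃ Fin n ⊕ Fin n) {Q : Matrix κ κ ℂ}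
    (hQ : IsUnit Q.det) :
    IsZariskiClosed (((symplecticGroupC (Fin n)).map (reindexSLC e.symm).toMonoidHom).map (conjGLC Q hQ).toMonoidHom) ∧
      (vanishingIdealC
        (((symplecticGroupC (Fin n)).map (reindexSLC e.symm).toMonoidHom).map (conjGLC Q hQ).toMonoidHom)).IsPrime :=
  ⟨((isZariskiClosed_symplecticGroupC (Fin n)).map_reindexSLC e.symm).map_conjGLC hQ,
    isPrime_vanishingIdealC_map_conjGLC hQ
      (isPrime_vanishingIdealC_map_reindexSLC e.symm (isPrime_vanishingIdealC_symplecticGroupC (Fin n)))⟩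

end ComplexSymplectic

/-! ## §2 Matrix algebra in a frame: general conjugates (the diagonal case is in the prequel) -/

section Frame

variable {ι : Type*} [Fintype ι] [DecidableEq ι]

/-- The symplectic condition in a frame, for an arbitrary matrix `B`: `ᵗ(P B P⁻¹) Γ (P B P⁻¹) = Γ ⟺ ᵗB H B = H`,
`H = ᵗP Γ P`. [cite: Milne1999LefschetzClasses, §2 Remark 2.2 («an `L`-linear automorphism … fixes `φ` if and only if it fixes `e_D`»)] -/
theorem conj_symplectic_iff {P Γ : Matrix ι ι ℂ} (hP : IsUnit P.det) (B : Matrix ι ι ℂ) :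
    (P * B * P⁻¹)ᵀ * Γ * (P * B * P⁻¹) = Γ ↔ Bᵀ * (Pᵀ * Γ * P) * B = Pᵀ * Γ * P := by
  have hT : (P * B * P⁻¹)ᵀ = P⁻¹ᵀ * Bᵀ * Pᵀ := by rw [Matrix.transpose_mul, Matrix.transpose_mul, Matrix.mul_assoc]
  have h1 : Pᵀ * P⁻¹ᵀ = 1 := by rw [← Matrix.transpose_mul, Matrix.nonsing_inv_mul _ hP, Matrix.transpose_one]
  have h2 : P⁻¹ᵀ * Pᵀ = 1 := by rw [← Matrix.transpose_mul, Matrix.mul_nonsing_inv _ hP, Matrix.transpose_one]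
  rw [hT]
  constructor
  · intro h
    have h' := congrArg (fun X ↦ Pᵀ * X * P) h
    rw [show Pᵀ * (P⁻¹ᵀ * Bᵀ * Pᵀ * Γ * (P * B * P⁻¹)) * P =
        Pᵀ * P⁻¹ᵀ * (Bᵀ * (Pᵀ * Γ * P) * B) * (P⁻¹ * P) by simp only [Matrix.mul_assoc],
      h1, Matrix.one_mul, Matrix.nonsing_inv_mul _ hP, Matrix.mul_one] at h'
    exact h'
  · intro h
    have h' := congrArg (fun X ↦ P⁻¹ᵀ * X * P⁻¹) h
    rw [show P⁻¹ᵀ * (Bᵀ * (Pᵀ * Γ * P) * B) * P⁻¹ = P⁻¹ᵀ * Bᵀ * Pᵀ * Γ * (P * B * P⁻¹) by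
        simp only [Matrix.mul_assoc],
      show P⁻¹ᵀ * (Pᵀ * Γ * P) * P⁻¹ = P⁻¹ᵀ * Pᵀ * Γ * (P * P⁻¹) by simp only [Matrix.mul_assoc],
      h2, Matrix.one_mul, Matrix.mul_nonsing_inv _ hP, Matrix.mul_one] at h'
    exact h'

/-- Commutation in a frame: `(P B P⁻¹)(P D P⁻¹) = (P D P⁻¹)(P B P⁻¹) ⟺ B D = D B`. [folklore] -/
private theorem conjFrame_mul_comm_iff {P : Matrix ι ι ℂ} (hP : IsUnit P.det) (B D : Matrix ι ι ℂ) :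
    P * B * P⁻¹ * (P * D * P⁻¹) = P * D * P⁻¹ * (P * B * P⁻¹) ↔ B * D = D * B := by
  have hl : ∀ X Y : Matrix ι ι ℂ, P * X * P⁻¹ * (P * Y * P⁻¹) = P * (X * Y) * P⁻¹ := fun X Y ↦ by
    rw [show P * X * P⁻¹ * (P * Y * P⁻¹) = P * X * (P⁻¹ * P) * Y * P⁻¹ by simp only [Matrix.mul_assoc],
      Matrix.nonsing_inv_mul _ hP, Matrix.mul_one, Matrix.mul_assoc P X]
  rw [hl, hl]
  constructor
  · intro h
    have h' := congrArg (fun X ↦ P⁻¹ * X * P) h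
    rw [show P⁻¹ * (P * (B * D) * P⁻¹) * P = P⁻¹ * P * (B * D) * (P⁻¹ * P) by simp only [Matrix.mul_assoc],
      show P⁻¹ * (P * (D * B) * P⁻¹) * P = P⁻¹ * P * (D * B) * (P⁻¹ * P) by simp only [Matrix.mul_assoc],
      Matrix.nonsing_inv_mul _ hP, Matrix.one_mul, Matrix.mul_one, Matrix.one_mul, Matrix.mul_one] at h'
    exact h'
  · intro h
    rw [h]

/-- A matrix commutes with `diag(c)` iff its entries vanish where `c` differs. [folklore] -/
private theorem mul_diagonal_comm_iff (B : Matrix ι ι ℂ) (c : ι → ℂ) :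
    B * diagonal c = diagonal c * B ↔ ∀ i k, c i ≠ c k → B i k = 0 := by
  constructor
  · intro h i k hik
    have h1 := congrFun (congrFun h i) k
    rw [mul_diagonal, diagonal_mul] at h1
    -- `B i k * c k = c i * B i k`
    have h2 : (c i - c k) * B i k = 0 := by linear_combination -h1
    exact (mul_eq_zero.1 h2).resolve_left (sub_ne_zero.2 hik)
  · intro h
    ext i k
    rw [mul_diagonal, diagonal_mul]
    by_cases hik : c i = c k
    · rw [hik, mul_comm]
    · rw [h i k hik, mul_zero, zero_mul]

end Frame

/-! ## §3 Milne 1999 §2 type I at torus level: `S(X)(ℂ)` for `End_ℚ(X)` commutative, reduced, Rosati-fixed -/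

section TypeOne

variable {ι : Type*} [Fintype ι] [DecidableEq ι] {E : Type*} [NormedAddCommGroup E] [NormedSpace ℂ E]
  (Φ : (ι → ℝ) ≃L[ℝ] E)

/-- `det (G ⊗ 1) ≠ 0`. [folklore] -/
private theorem isUnit_det_map_algebraMap_rm {G : Matrix ι ι ℚ} (hGu : IsUnit G.det) :
    IsUnit (G.map (algebraMap ℚ ℂ)).det := by
  rw [show G.map (algebraMap ℚ ℂ) = (algebraMap ℚ ℂ).mapMatrix G from rfl, ← RingHom.map_det]
  exact hGu.map _

omit [Fintype ι] [DecidableEq ι] in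
/-- `ᵗ(G ⊗ 1) = -(G ⊗ 1)`. [folklore] -/
private theorem transpose_map_algebraMap_rm {G : Matrix ι ι ℚ} (hGt : Gᵀ = -G) :
    (G.map (algebraMap ℚ ℂ))ᵀ = -G.map (algebraMap ℚ ℂ) := by
  rw [← Matrix.transpose_map, hGt, Matrix.map_neg _ (map_neg (algebraMap ℚ ℂ))]

/-- **MILNE 1999 §2, «SIMPLE ABELIAN VARIETY OF TYPE I», AT TORUS LEVEL — `S(X)(ℂ)` IS CONNECTED (its complex
vanishing ideal is prime).** Let `X = E/Φ(ℤ^ι)` be a complex torus whose endomorphism algebra `End_ℚ(X)` is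
commutative and reduced, and let `G ∈ M_ι(ℚ)` be alternating and non-degenerate with `rosati G A = A` for every
`A ∈ End_ℚ(X)` (the Rosati involution is trivial on `End_ℚ(X) = F`: real multiplication, type I). In a common
eigenbasis `P` of `F ⊗ ℂ` (`A ⊗ 1 = P diag(c_A) P⁻¹`) the eigenlines are partitioned by character
`σ = (A ↦ c_A(i))`: «`V(A) = V₁ ⊕ ⋯ ⊕ V_t`, `V_i = e_i V` … Any `k`-linear map `α` commuting with the action of `F`
decomposes into `α = α₁ ⊕ ⋯ ⊕ α_t`»; the frame Gram matrix `H = ᵗP Γ P` is block diagonal since `†` is trivial on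
`F` («`φ = φ₁ ⊕ ⋯ ⊕ φ_t` … `φ_i` is a nondegenerate skew-symmetric form on `V_i`»), so
`S(X)(ℂ) = P · ∏_σ Sp(H_σ) · P⁻¹` («`S(A)_{k^al} ≅ ∏_{σ : F → k^al} Sp(φ_σ)`»), a product of `GL`-conjugates of standard
symplectic groups, each irreducible, and the product is irreducible: «Type I ∣ Sp ∣ Semisimple: Yes ∣ Connected:
Yes». [cite: Milne1999LefschetzClasses, §2 Preliminaries (p. 646), «Simple abelian variety of type I» (p. 648–649) and Summary table (p. 652)]
[cite: Springer1998, Exercise 2.2.9 (1)(b), Thm. 1.5.4 (ii), Prop. 2.2.1] -/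
theorem isPrime_vanishingIdealC_lefschetzGroupC_of_rosati_eq_self [IsReduced (endAlgRat Φ)]
    (hcomm : ∀ a ∈ endAlgRat Φ, ∀ b ∈ endAlgRat Φ, a * b = b * a)
    {G : Matrix ι ι ℚ} (hGt : Gᵀ = -G) (hGu : IsUnit G.det) (hRos : ∀ A ∈ endAlgRat Φ, rosati G A = A) :
    (vanishingIdealC (lefschetzGroupC Φ G)).IsPrime := by
  classical
  set Γ : Matrix ι ι ℂ := G.map (algebraMap ℚ ℂ) with hΓ_def
  have hΓu : IsUnit Γ.det := isUnit_det_map_algebraMap_rm hGu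
  have hΓt : Γᵀ = -Γ := transpose_map_algebraMap_rm hGt
  -- a common eigenbasis `P` of `F ⊗ ℂ` and the characters `c`
  obtain ⟨P, hP, hT⟩ := exists_forall_map_eq_conj_diagonal (endAlgRat Φ) hcomm
  choose! c hc using hT
  -- the frame Gram matrix
  obtain ⟨hHt, hHkk, -⟩ := frameGram_alternating hP hΓu hΓt
  set H : Matrix ι ι ℂ := Pᵀ * Γ * P with hH_def
  have hHu : IsUnit H.det := by
    rw [hH_def, det_mul, det_mul, det_transpose]
    exact (hP.mul hΓu).mul hP
  -- `†` trivial on `F`: `H` respects the characters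
  have hHzero : ∀ i k, (∃ t ∈ endAlgRat Φ, c t i ≠ c t k) → H i k = 0 := by
    rintro i k ⟨t, ht, hik⟩
    have hros : rosati Γ (t.map (algebraMap ℚ ℂ)) = t.map (algebraMap ℚ ℂ) := by
      rw [hΓ_def, ← rosati_map (algebraMap ℚ ℂ) hGu t, hRos t ht]
    rw [hc t ht] at hros
    have h := (rosati_conj_diagonal_eq_iff hP hΓu (c t) (c t)).1 hros
    rw [← hH_def] at h
    have h1 := congrFun (congrFun h i) k
    rw [diagonal_mul, mul_diagonal] at h1
    have h2 : (c t i - c t k) * H i k = 0 := by linear_combination h1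
    exact (mul_eq_zero.1 h2).resolve_left (sub_ne_zero.2 hik)
  -- the partition of the eigenlines by character
  let s : Setoid ι := ⟨fun i k ↦ ∀ t ∈ endAlgRat Φ, c t i = c t k,
    ⟨fun _ _ _ ↦ rfl, fun h t ht ↦ (h t ht).symm, fun h₁ h₂ t ht ↦ (h₁ t ht).trans (h₂ t ht)⟩⟩
  have hs : ∀ i k, s.r i k ↔ ∀ t ∈ endAlgRat Φ, c t i = c t k := fun _ _ ↦ Iff.rfl
  let cls : ι → Quotient s := Quotient.mk s
  have hcls : ∀ i k, cls i = cls k ↔ ∀ t ∈ endAlgRat Φ, c t i = c t k := fun i k ↦ Quotient.eq (r := s)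
  let fib : Quotient s → Type _ := fun q ↦ {i : ι // cls i = q}
  let eσ : (Σ q, fib q) ≃ ι := Equiv.sigmaFiberEquiv cls
  have heσ : ∀ p : Σ q, fib q, cls (eσ p) = p.1 := fun p ↦ p.2.2
  have hne_iff : ∀ p p' : Σ q, fib q, p.1 ≠ p'.1 ↔ ∃ t ∈ endAlgRat Φ, c t (eσ p) ≠ c t (eσ p') := fun p p' ↦ by
    rw [← heσ p, ← heσ p', Ne, hcls, not_forall]
    exact exists_congr fun t ↦ by rw [Classical.not_imp]
  -- the reindexed Gram matrix is block diagonal with alternating invertible blocks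
  set H' : Matrix (Σ q, fib q) (Σ q, fib q) ℂ := H.submatrix eσ eσ with hH'_def
  set Hb : ∀ q, Matrix (fib q) (fib q) ℂ := fun q ↦ Matrix.blockDiag' H' q with hHb_def
  have hH'zero : ∀ p p' : Σ q, fib q, p.1 ≠ p'.1 → H' p p' = 0 := fun p p' hpp' ↦
    hHzero _ _ ((hne_iff p p').1 hpp')
  have hH'eq : H' = Matrix.blockDiagonal' Hb := eq_blockDiagonal'_blockDiag'_of_apply_eq_zero hH'zero
  have hHbt : ∀ q, (Hb q)ᵀ = -Hb q := fun q ↦ by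
    ext x y
    have h := congrFun (congrFun hHt (eσ ⟨q, x⟩)) (eσ ⟨q, y⟩)
    rw [transpose_apply, Matrix.neg_apply] at h
    rw [transpose_apply, Matrix.neg_apply]
    change H (eσ ⟨q, y⟩) (eσ ⟨q, x⟩) = -H (eσ ⟨q, x⟩) (eσ ⟨q, y⟩)
    exact h
  have hHbu : ∀ q, IsUnit (Hb q).det := fun q ↦ by
    refine isUnit_det_of_isUnit_det_blockDiagonal' ?_ q
    rw [← hH'eq, hH'_def, Matrix.det_submatrix_equiv_self]
    exact hHu
  -- the blocks `Sp(H_q)(ℂ)`, transported standard symplectic groups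
  have hSB : ∀ q, ∃ (n : ℕ) (e : fib q ≃ Fin n ⊕ Fin n) (Q : Matrix (fib q) (fib q) ℂ), IsUnit Q.det ∧
      Qᵀ * Hb q * Q = (Matrix.J (Fin n) ℂ).submatrix e e := fun q ↦
    exists_transpose_mul_mul_eq_J_submatrix_complex (hHbt q) (hHbu q)
  choose n e Q hQ hQHQ using hSB
  let K : ∀ q, Subgroup (Matrix.SpecialLinearGroup (fib q) ℂ) := fun q ↦
    ((symplecticGroupC (Fin (n q))).map (reindexSLC (e q).symm).toMonoidHom).map (conjGLC (Q q) (hQ q)).toMonoidHom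
  have hKmem : ∀ q (N : Matrix.SpecialLinearGroup (fib q) ℂ), N ∈ K q ↔ N.1ᵀ * Hb q * N.1 = Hb q := fun q N ↦
    mem_map_map_symplecticGroupC_iff (hQ q) (hQHQ q)
  have hKc : ∀ q, IsZariskiClosed (K q) := fun q ↦ (isZariskiClosed_and_isPrime_map_map_symplecticGroupC (e q) (hQ q)).1
  have hKp : ∀ q, (vanishingIdealC (K q)).IsPrime := fun q ↦
    (isZariskiClosed_and_isPrime_map_map_symplecticGroupC (e q) (hQ q)).2
  -- the product and its transport
  have hprime := isPrime_vanishingIdealC_sigmaPi_map hKc hKp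
  suffices hS : lefschetzGroupC Φ G =
      (((Subgroup.pi Set.univ K).map (sigmaBlockDiagSL fib ℂ)).map (reindexSLC eσ).toMonoidHom).map
        (conjGLC P hP).toMonoidHom by
    rw [hS]
    exact isPrime_vanishingIdealC_map_conjGLC hP (isPrime_vanishingIdealC_map_reindexSLC eσ hprime)
  -- the identification `S(X)(ℂ) = P · ∏_q Sp(H_q) · P⁻¹`
  ext M
  rw [Subgroup.mem_map_equiv, Subgroup.mem_map_equiv, mem_lefschetzGroupC_iff]
  -- `B = P⁻¹ M P`, `B' = B` reindexed
  set B : Matrix ι ι ℂ := P⁻¹ * (M : Matrix ι ι ℂ) * P with hB_def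
  have hMB : (M : Matrix ι ι ℂ) = P * B * P⁻¹ := by
    rw [hB_def, show P * (P⁻¹ * (M : Matrix ι ι ℂ) * P) * P⁻¹ = P * P⁻¹ * (M : Matrix ι ι ℂ) * (P * P⁻¹) by
      simp only [Matrix.mul_assoc], Matrix.mul_nonsing_inv _ hP, Matrix.one_mul, Matrix.mul_one]
  have hcoeB' : (((reindexSLC eσ).symm ((conjGLC P hP).symm M) : Matrix.SpecialLinearGroup (Σ q, fib q) ℂ) :
      Matrix (Σ q, fib q) (Σ q, fib q) ℂ) = B.submatrix eσ eσ := by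
    rw [coe_reindexSLC_symm, coe_conjGLC_symm]
  -- (1) the symplectic condition ⟺ blockwise symplectic conditions (for block matrices)
  have hsymp_iff : (M : Matrix ι ι ℂ)ᵀ * Γ * (M : Matrix ι ι ℂ) = Γ ↔
      (B.submatrix eσ eσ)ᵀ * H' * B.submatrix eσ eσ = H' := by
    rw [hMB, conj_symplectic_iff hP, ← hH_def, hH'_def]
    constructor
    · intro h
      rw [show (B.submatrix ⇑eσ ⇑eσ)ᵀ = Bᵀ.submatrix eσ eσ from (Matrix.transpose_submatrix _ _ _).symm,
        Matrix.submatrix_mul_equiv, Matrix.submatrix_mul_equiv, h]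
    · intro h
      rw [show (B.submatrix ⇑eσ ⇑eσ)ᵀ = Bᵀ.submatrix eσ eσ from (Matrix.transpose_submatrix _ _ _).symm,
        Matrix.submatrix_mul_equiv, Matrix.submatrix_mul_equiv] at h
      have h2 := congrArg (fun Y : Matrix _ _ ℂ ↦ Y.submatrix eσ.symm eσ.symm) h
      simp only [Matrix.submatrix_submatrix, Equiv.self_comp_symm, Matrix.submatrix_id_id] at h2
      exact h2
  -- (2) commuting with `F ⊗ 1` ⟺ vanishing off the character blocks
  have hcomm_iff : (∀ A ∈ endAlgRat Φ, (M : Matrix ι ι ℂ) * A.map (algebraMap ℚ ℂ) = A.map (algebraMap ℚ ℂ) * M) ↔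
      ∀ p p' : Σ q, fib q, p.1 ≠ p'.1 → B.submatrix eσ eσ p p' = 0 := by
    constructor
    · intro h p p' hpp'
      obtain ⟨t, ht, hne⟩ := (hne_iff p p').1 hpp'
      have h1 := h t ht
      rw [hMB, hc t ht, conjFrame_mul_comm_iff hP, mul_diagonal_comm_iff] at h1
      exact h1 _ _ hne
    · intro h A hA
      rw [hMB, hc A hA, conjFrame_mul_comm_iff hP, mul_diagonal_comm_iff]
      intro i k hik
      have h1 := h (eσ.symm i) (eσ.symm k) ((hne_iff _ _).2 ⟨A, hA, by rwa [Equiv.apply_symm_apply, Equiv.apply_symm_apply]⟩)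
      rwa [Matrix.submatrix_apply, Equiv.apply_symm_apply, Equiv.apply_symm_apply] at h1
  rw [hsymp_iff, hcomm_iff]
  constructor
  · -- `S(X)(ℂ) ⊆ P · ∏ Sp(H_q) · P⁻¹`
    rintro ⟨hsymp, hblk⟩
    set B' := B.submatrix eσ eσ with hB'_def
    have hB'eq : B' = Matrix.blockDiagonal' (Matrix.blockDiag' B') := eq_blockDiagonal'_blockDiag'_of_apply_eq_zero hblk
    -- blockwise symplectic
    have hblocks : ∀ q, (Matrix.blockDiag' B' q)ᵀ * Hb q * Matrix.blockDiag' B' q = Hb q := by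
      have h := hsymp
      rw [hB'eq, hH'eq, Matrix.blockDiagonal'_transpose, ← Matrix.blockDiagonal'_mul, ← Matrix.blockDiagonal'_mul] at h
      exact fun q ↦ congrFun (Matrix.blockDiagonal'_injective h) q
    have hdet : ∀ q, (Matrix.blockDiag' B' q).det = 1 := fun q ↦
      det_eq_one_of_transpose_mul_mul_eq_complex (hHbt q) (hHbu q) (hblocks q)
    have hmem := eq_sigmaBlockDiagSL_of_apply_eq_zero (M := (reindexSLC eσ).symm ((conjGLC P hP).symm M))
      (by rw [hcoeB']; exact hblk) (by rw [hcoeB']; exact hdet)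
    rw [hmem]
    refine Subgroup.mem_map.2 ⟨_, (Subgroup.mem_pi _).2 fun q _ ↦ (hKmem q _).2 ?_, rfl⟩
    change (Matrix.blockDiag' _ q)ᵀ * Hb q * Matrix.blockDiag' _ q = Hb q
    rw [hcoeB']
    exact hblocks q
  · -- `P · ∏ Sp(H_q) · P⁻¹ ⊆ S(X)(ℂ)`
    intro hmem
    obtain ⟨A, hA, hAeq⟩ := Subgroup.mem_map.1 hmem
    have hB' : B.submatrix eσ eσ = Matrix.blockDiagonal' fun q ↦ ((A q : Matrix.SpecialLinearGroup (fib q) ℂ) :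
        Matrix (fib q) (fib q) ℂ) := by
      rw [← hcoeB', ← hAeq, coe_sigmaBlockDiagSL]
    have hAq : ∀ q, ((A q : Matrix.SpecialLinearGroup (fib q) ℂ) : Matrix (fib q) (fib q) ℂ)ᵀ * Hb q * (A q) = Hb q :=
      fun q ↦ (hKmem q (A q)).1 ((Subgroup.mem_pi _).1 hA q (Set.mem_univ q))
    refine ⟨?_, fun p p' hpp' ↦ ?_⟩
    · rw [hB', hH'eq, Matrix.blockDiagonal'_transpose, ← Matrix.blockDiagonal'_mul, ← Matrix.blockDiagonal'_mul]
      exact congrArg Matrix.blockDiagonal' (funext hAq)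
    · rw [hB']
      obtain ⟨q, x⟩ := p
      obtain ⟨q', y⟩ := p'
      exact Matrix.blockDiagonal'_apply_ne _ x y hpp'

/-- **`Lf(X)(ℂ) = S(X)(ℂ)` for a complex torus with real multiplication** (`End_ℚ(X)` commutative, reduced, pointwise
fixed by the Rosati involution of the alternating non-degenerate rational `G`): Lange's identity component `Lf(X)` is
all of Milne's `S(X)` — Milne's table, type I «Connected: Yes», every degree `e = [F : ℚ]` (the case `e = 1`,
`End_ℚ(X) = ℚ`, is `ComplexTorusSymplecticGroupGramConnected`'s `…_of_endAlgRat_eq_bot`).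
[cite: Milne1999LefschetzClasses, §2 «Simple abelian variety of type I» and Summary table (p. 652)]
[cite: Lange2023AbelianVarietiesComplex, §7.2.4 Exercise (4)] -/
theorem lefschetzIdentityC_eq_lefschetzGroupC_of_rosati_eq_self [IsReduced (endAlgRat Φ)]
    (hcomm : ∀ a ∈ endAlgRat Φ, ∀ b ∈ endAlgRat Φ, a * b = b * a)
    {G : Matrix ι ι ℚ} (hGt : Gᵀ = -G) (hGu : IsUnit G.det) (hRos : ∀ A ∈ endAlgRat Φ, rosati G A = A) :
    lefschetzIdentityC Φ G = lefschetzGroupC Φ G :=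
  lefschetzIdentityC_eq_of_isPrime Φ (isPrime_vanishingIdealC_lefschetzGroupC_of_rosati_eq_self Φ hcomm hGt hGu hRos)

/-- **The polarised form: for a polarised abelian variety `(X, η)` whose endomorphism algebra is commutative and
pointwise fixed by the Rosati involution of `η` (real multiplication by the totally real field `F = End_ℚ(X)`, type
I), `Lf(X)(ℂ) = S(X)(ℂ)`.** (`End_ℚ(X)` is semisimple by Poincaré, hence reduced; `G` is alternating and
non-degenerate.) [cite: Milne1999LefschetzClasses, §2 type I («`S(A)_{k^al} ≅ ∏ Sp(φ_σ)`») and Summary table («I ∣ Sp ∣ Yes ∣ Yes»)]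
[cite: Lange2023AbelianVarietiesComplex, §2.4.1 Lemma 2.4.1, §7.2.4 Exercise (4)] -/
theorem IsRiemannForm.lefschetzIdentityC_eq_lefschetzGroupC_of_rosati_eq_self {Φ : (ι → ℝ) ≃L[ℝ] E}
    {η : E [⋀^Fin 2]→L[ℝ] ℝ} (hη : IsRiemannForm Φ η) {G : Matrix ι ι ℚ}
    (hG : G.map (Rat.cast : ℚ → ℝ) = latticeGram Φ η)
    (hcomm : ∀ a ∈ endAlgRat Φ, ∀ b ∈ endAlgRat Φ, a * b = b * a) (hRos : ∀ A ∈ endAlgRat Φ, rosati G A = A) :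
    lefschetzIdentityC Φ G = lefschetzGroupC Φ G := by
  haveI := hη.isSemisimpleRing_endAlgRat
  letI : CommRing (endAlgRat Φ) :=
    { (inferInstance : Ring (endAlgRat Φ)) with mul_comm := fun a b ↦ Subtype.ext (hcomm a.1 a.2 b.1 b.2) }
  haveI : IsReduced (endAlgRat Φ) := inferInstance
  exact ComplexTorus.lefschetzIdentityC_eq_lefschetzGroupC_of_rosati_eq_self Φ hcomm
    (transpose_eq_neg_of_map_ratCast Φ hG) (isUnit_det_of_map_ratCast hG hη.isUnit_det_latticeGram) hRos

/-- The polarised form, irreducibility: `I_ℂ(S(X)(ℂ))` is prime. [cite: Milne1999LefschetzClasses, §2 Summary table (type I: «Connected: Yes»)] -/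
theorem IsRiemannForm.isPrime_vanishingIdealC_lefschetzGroupC_of_rosati_eq_self {Φ : (ι → ℝ) ≃L[ℝ] E}
    {η : E [⋀^Fin 2]→L[ℝ] ℝ} (hη : IsRiemannForm Φ η) {G : Matrix ι ι ℚ}
    (hG : G.map (Rat.cast : ℚ → ℝ) = latticeGram Φ η)
    (hcomm : ∀ a ∈ endAlgRat Φ, ∀ b ∈ endAlgRat Φ, a * b = b * a) (hRos : ∀ A ∈ endAlgRat Φ, rosati G A = A) :
    (vanishingIdealC (lefschetzGroupC Φ G)).IsPrime := by
  rw [isPrime_vanishingIdealC_lefschetzGroupC_iff]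
  exact hη.lefschetzIdentityC_eq_lefschetzGroupC_of_rosati_eq_self hG hcomm hRos

/-- Real points: `Lf(X)(ℝ) = S(X)(ℝ) = lefschetzGroup Φ η` for real multiplication.
[cite: Milne1999LefschetzClasses, §2 type I («`S(A) = S₁ × ⋯ × S_t`, `S_i = Res_{F_i/k} Sp(φ_i)`»)] [cite: Lange2023AbelianVarietiesComplex, §7.2.4 Exercise (4)] -/
theorem IsRiemannForm.lefschetzIdentity_eq_lefschetzGroup_of_rosati_eq_self {Φ : (ι → ℝ) ≃L[ℝ] E}
    {η : E [⋀^Fin 2]→L[ℝ] ℝ} (hη : IsRiemannForm Φ η) {G : Matrix ι ι ℚ}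
    (hG : G.map (Rat.cast : ℚ → ℝ) = latticeGram Φ η)
    (hcomm : ∀ a ∈ endAlgRat Φ, ∀ b ∈ endAlgRat Φ, a * b = b * a) (hRos : ∀ A ∈ endAlgRat Φ, rosati G A = A) :
    lefschetzIdentity Φ G = lefschetzGroup Φ η := by
  rw [← comap_lefschetzGroupC Φ hG, ← hη.lefschetzIdentityC_eq_lefschetzGroupC_of_rosati_eq_self hG hcomm hRos]
  rfl

end TypeOne

/-! ## §4 Through the isogeny factors: real and complex multiplication factors mixed -/

section IsogenyFactors

variable {K : Type*} [Fintype K] [DecidableEq K] {σ : K → Type*} [∀ k, Fintype (σ k)] [∀ k, DecidableEq (σ k)]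
  {F : K → Type*} [∀ k, NormedAddCommGroup (F k)] [∀ k, NormedSpace ℂ (F k)] [∀ k, FiniteDimensional ℂ (F k)]
  {Ψ : ∀ k, (σ k → ℝ) ≃L[ℝ] F k} {ω : ∀ k, F k [⋀^Fin 2]→L[ℝ] ℝ} {G : ∀ k, Matrix (σ k) (σ k) ℚ} {n : K → ℕ}
  {ι : Type*} [Fintype ι] [DecidableEq ι] {E : Type*} [NormedAddCommGroup E] [NormedSpace ℂ E]
  {Φ : (ι → ℝ) ≃L[ℝ] E} {η : E [⋀^Fin 2]→L[ℝ] ℝ} {G₀ : Matrix ι ι ℚ}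

/-- **An abelian variety isogenous to a product of powers of polarised factors with COMMUTATIVE endomorphism
algebras, each either pointwise Rosati-fixed (real multiplication, type I with `E = F`) or of dimension `2 dim B_k`
(complex multiplication, type IV with `E = K`), has connected `S(X)`: `Lf(X)(ℂ) = S(X)(ℂ)`** (Milne's Prop. 1.5
`S(A₁) × ⋯ × S(A_s) → S(A)` with the «Connected: Yes» entries I and IV of the table; `Hom_ℚ(B_k, B_l) = 0` for `k ≠ l`,
`n_k ≥ 1`). [cite: Milne1999LefschetzClasses, §1 Prop. 1.5 (p. 644) and §2 Summary table (p. 652: «I … Yes», «IV … Yes»)]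
[cite: Gordon1999HodgeAVSurvey, 2.15 Lemma and §7.7] -/
theorem IsIsogenous.lefschetzIdentityC_eq_lefschetzGroupC_of_powers_of_rosati_eq_self_or_comm
    (hX : IsIsogenous Φ (sigmaPiPeriod fun k ↦ powPeriod (Ψ k) (n k))) (hη : IsRiemannForm Φ η)
    (hG₀ : G₀.map (Rat.cast : ℚ → ℝ) = latticeGram Φ η) (h : ∀ k, IsRiemannForm (Ψ k) (ω k))
    (hG : ∀ k, (G k).map (Rat.cast : ℚ → ℝ) = latticeGram (Ψ k) (ω k))
    (hhom : ∀ k l, k ≠ l → homRat (Ψ l) (Ψ k) = ⊥) (hn : ∀ k, 0 < n k)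
    (hcomm : ∀ k, ∀ a ∈ endAlgRat (Ψ k), ∀ b ∈ endAlgRat (Ψ k), a * b = b * a)
    (hfac : ∀ k, (∀ A ∈ endAlgRat (Ψ k), rosati (G k) A = A) ∨
      Module.finrank ℚ (endAlgRat (Ψ k)) = Fintype.card (σ k)) :
    lefschetzIdentityC Φ G₀ = lefschetzGroupC Φ G₀ :=
  hX.lefschetzIdentityC_eq_lefschetzGroupC_of_powers hη hG₀ h hG hhom hn fun k ↦ (hfac k).elim
    (fun hRos ↦ (h k).lefschetzIdentityC_eq_lefschetzGroupC_of_rosati_eq_self (hG k) (hcomm k) hRos)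
    fun hdim ↦ (h k).lefschetzIdentityC_eq_lefschetzGroupC_of_endAlgRat_comm (hG k) (hcomm k) hdim

/-- The same, irreducibility form: `I_ℂ(S(X)(ℂ))` is prime. [cite: Milne1999LefschetzClasses, §1 Prop. 1.5 and §2 Summary table] -/
theorem IsIsogenous.isPrime_vanishingIdealC_lefschetzGroupC_of_powers_of_rosati_eq_self_or_comm
    (hX : IsIsogenous Φ (sigmaPiPeriod fun k ↦ powPeriod (Ψ k) (n k))) (hη : IsRiemannForm Φ η)
    (hG₀ : G₀.map (Rat.cast : ℚ → ℝ) = latticeGram Φ η) (h : ∀ k, IsRiemannForm (Ψ k) (ω k))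
    (hG : ∀ k, (G k).map (Rat.cast : ℚ → ℝ) = latticeGram (Ψ k) (ω k))
    (hhom : ∀ k l, k ≠ l → homRat (Ψ l) (Ψ k) = ⊥) (hn : ∀ k, 0 < n k)
    (hcomm : ∀ k, ∀ a ∈ endAlgRat (Ψ k), ∀ b ∈ endAlgRat (Ψ k), a * b = b * a)
    (hfac : ∀ k, (∀ A ∈ endAlgRat (Ψ k), rosati (G k) A = A) ∨
      Module.finrank ℚ (endAlgRat (Ψ k)) = Fintype.card (σ k)) :
    (vanishingIdealC (lefschetzGroupC Φ G₀)).IsPrime := by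
  rw [isPrime_vanishingIdealC_lefschetzGroupC_iff]
  exact hX.lefschetzIdentityC_eq_lefschetzGroupC_of_powers_of_rosati_eq_self_or_comm hη hG₀ h hG hhom hn hcomm hfac

end IsogenyFactors

end ComplexTorus

end Literature.Geometry.Kaehler
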